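import Literature.AnabelianGeometry.SemiGraphs.TemperoidsGaloisTorsorProofs
import HarnessLib

/-!
# [SemiAnbd] Def. 3.1 (iv) / Rmk. 3.1.3: a Galois object of `B^temp(Π)` is an `Aut`-torsor over every CONNECTED target —
# `Aut(A)` acts transitively by PRE-composition on `Hom(A, T)`

Mochizuki, *Semi-graphs of anabelioids*, Publ. RIMS **42** (2006) 221–322, §3, author's manuscript p. 33 (Def. 3.1 (iv):
"A connected object `T` of a temperoid `T` will be called *Galois* if, for any two arrows `ψ₁, ψ₂ : S → T` of `T`, where
`S` is connected, there exists a [unique] automorphism `α ∈ Aut_T(T)` of `T` such that `ψ₁ = α ∘ ψ₂`") and p. 34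
(Rmk. 3.1.3: the Galois objects of `B^temp(Π)` are the `Π/N`, `N ⊆ Π` open normal, and `Aut(Π/N) = Π/N` acts simply
transitively) [cite: MochizukiSemiAnbd2006, Def 3.1(iv) p.33; Rmk 3.1.3 p.34].

PROOF-ONLY (no definitions).  abc-iut cell, layer L2 row #5-R43 «P55/T56 FIXED-SOURCE LEAVES (G) hgal + hproj at
`ofBiKummerData`» (seat abc-iut-w4-d099), MODEL THEOREM behind leaf (G): the binder `hgal` of abc-iut-w5-d020's
`ThetaFrobenioid.cyclotomicRigidity_ofBiKummerData_of_laws` (`EtaleTheta/Discharge/Sec5CyclotomicRigidityOfBiKummerDataLaws.lean`;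
[EtTh] Prop. 5.5 proof p.328 (PDF p.102) "we may transport this isomorphism from `S″` to an arbitrary (l, N)-theta-saturated
`S ∈ Ob(C)` by means of linear morphisms `S″ → S`, `S″ → S‴` … independent of the choice") asks that the BASE parts of two
linear morphisms `B_N → T` differ by an automorphism of the Galois base object `B_N^bs`.  Over the abstract base category of
the §4 setting that is a LAW (the setting knows Galois objects only through one surjection `Π^tp_X ↠ Aut_D(A)` each); here
it is PROVED for the genuine base `B^temp(Π)⁰`:

* `exists_aut_comp_eq_of_isGaloisObj` — for a Galois object `A` and a CONNECTED object `T` of `B^temp(Π)` and any two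
  morphisms `b, b′ : A → T` there is `σ ∈ Aut(A)` with `b′ = b ∘ σ` (the DUAL of the defining property of Def. 3.1 (iv),
  which is transitivity by POST-composition INTO a Galois object);
* `exists_aut_comp_eq_of_isGaloisObj_connectedPart` — the same in the full subcategory `B^temp(Π)⁰` of connected
  objects (the base category `D` of the tempered Frobenioids of [EtTh] §3–§5; [EtTh] Def. 3.6 (ii) "a connected, totally
  epimorphic category").

Method: one-point determination of morphisms out of a single orbit (`hom_eq_of_apply_eq`), transitivity of `Π` on the
connected target (`exists_ρ_eq_of_isConnectedObj`) and of `Aut(A)` on the Galois source (`exists_aut_apply_eq_of_isGaloisObj`).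
HONEST NOTE: the statement is FALSE in `B^temp(Π)` for a disconnected target (`inl, inr : A → A ⊔ A` differ by no
automorphism of `A`) — hence the hypothesis `IsConnectedObj T`, automatic in `B^temp(Π)⁰`.  Plain group/category theory; no
statement of the paper is strengthened; nothing here bears on [IUTchIII] Cor. 3.12.
-/

open CategoryTheory

namespace Literature.AnabelianGeometry.SemiGraphs

open Literature.AlgebraicGeometry.Frobenioids (IsConnectedObj ConnectedPart)
open Literature.AlgebraicGeometry.Frobenioids.QuasiTemperoid.BTempConnected

universe u

namespace GaloisObjects

variable {G : Type u} [Group G] [TopologicalSpace G]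

/-- **A Galois object is an `Aut`-torsor over every connected target** ([SemiAnbd] Def. 3.1 (iv) / Rmk. 3.1.3, dual form):
for `A` Galois and `T` connected in `B^temp(Π)` and morphisms `b, b′ : A → T` there is `σ ∈ Aut(A)` with `b′ = σ ≫ b`
(i.e. `b′ = b ∘ σ`).  [cite: MochizukiSemiAnbd2006, Rmk 3.1.3 p.34] -/
theorem exists_aut_comp_eq_of_isGaloisObj (A T : BTemp G) (hA : IsGaloisObj A) (hT : IsConnectedObj T)
    (b b' : A ⟶ T) : ∃ σ : Aut A, b' = σ.hom ≫ b := by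
  obtain ⟨x₀⟩ := nonempty_of_isConnectedObj A hA.1
  -- the target is a single orbit: `b′(x₀) = g · b(x₀)`
  obtain ⟨g, hg⟩ := exists_ρ_eq_of_isConnectedObj T hT (b.hom.hom x₀) (b'.hom.hom x₀)
  -- the source is Galois: some automorphism moves `x₀` to `g · x₀`
  obtain ⟨σ, hσ⟩ := GaloisTorsor.exists_aut_apply_eq_of_isGaloisObj A hA x₀ (A.obj.ρ g x₀)
  refine ⟨σ, hom_eq_of_apply_eq hA.1 b' (σ.hom ≫ b) x₀ ?_⟩
  change (b'.hom.hom x₀ : T.obj.V) = b.hom.hom (σ.hom.hom.hom x₀)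
  rw [hσ, hom_ρ, hg]

/-- The same with the automorphism on the other side of the equation: `σ ≫ b′ = b`.
[cite: MochizukiSemiAnbd2006, Rmk 3.1.3 p.34] -/
theorem exists_aut_comp_eq_of_isGaloisObj' (A T : BTemp G) (hA : IsGaloisObj A) (hT : IsConnectedObj T)
    (b b' : A ⟶ T) : ∃ σ : Aut A, σ.hom ≫ b' = b := by
  obtain ⟨σ, hσ⟩ := exists_aut_comp_eq_of_isGaloisObj A T hA hT b' b
  exact ⟨σ, hσ.symm⟩

/-- **The law (G) of [EtTh] Prop. 5.5's transport step, PROVED for the genuine base category `D = B^temp(Π)⁰`**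
(connected objects; [EtTh] Def. 3.6 (ii)): for `A` Galois (as an object of `B^temp(Π)`) and ANY object `T` of `B^temp(Π)⁰`,
two morphisms `b, b′ : A → T` of `B^temp(Π)⁰` differ by an automorphism of `A`: `b′ = σ ≫ b`.
[cite: MochizukiSemiAnbd2006, Rmk 3.1.3 p.34] -/
theorem exists_aut_comp_eq_of_isGaloisObj_connectedPart (A T : ConnectedPart (BTemp G)) (hA : IsGaloisObj A.obj)
    (b b' : A ⟶ T) : ∃ σ : Aut A, b' = σ.hom ≫ b := by
  obtain ⟨σ, hσ⟩ := exists_aut_comp_eq_of_isGaloisObj A.obj T.obj hA T.property b.hom b'.hom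
  exact ⟨(Literature.AlgebraicGeometry.Frobenioids.connectedObjects (BTemp G)).isoMk σ, ObjectProperty.hom_ext _ hσ⟩

end GaloisObjects

end Literature.AnabelianGeometry.SemiGraphs
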